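import Literature.MathematicalPhysics.QuantumFieldTheory.Balaban1983to89.B9Eq331PureGaugeResolventConjugation

/-!
# `Balaban1983to89.B9Eq331PureGaugeResolventLetters` — T. Bałaban, *Propagators for lattice gauge theories in a background field*, Commun. Math. Phys. **99**
# (1985) 389–434 [Balaban1985BackgroundPropagators] (3.8) p. 392 (`D*_U` is the adjoint of `D_U`), (3.23) p. 394 (`Δ^η_U = D*_UD_U ≥ 0`), (3.28)–(3.31) p. 395
# (gauge transformations; `R(u)` unitary), (3.39) p. 397 (the sup norm): **THE PURE-GAUGE RESOLVENT `(Δ^η_{U⁰} + m)⁻¹`, `U⁰ = 1^g`, AS AN OBJECT OF THE CHAIN —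
# the transporters of a pure gauge are mutually ADJOINT fibre isometries (`hRS` from `hAd`), `re⟪f, Δ_{U⁰}f⟫ = ‖∇_{U⁰}f‖² ≥ 0`, so `Δ_{U⁰} + m` is re-positive
# for `m > 0` and `B11Eq103H1Complex.greenK` inverts it: for every datum `h` the solution `u = (Δ_{U⁰} + m)⁻¹h` of `Δ_{U⁰}u + m u = h` EXISTS, is unique, and obeys
# the value row `‖u(x)‖ ≤ sup‖h‖∕m` (`B9Eq323KatoDomination`)** — the comparison resolvent `R⁰` of storey J's gradient-row bootstrap (the map behind the `hT`
# binder of `B9Eq342GradientRowBootstrap` §4, whose gradient row is `B9Eq331PureGaugeResolventConjugation` §4)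

statement-level skeleton of published theorems with citation tags; proofs where landed; nothing here is a claim about the Yang–Mills mass gap

CITATION HEADER (lean-in-tree rule).  Audit cell `pub-balaban`, sub-cell `t4`, BINDER row NE9; filed by NE9 crux-team LEAF PROVER 05
(`b2b-balaban-t4-ne9-formalise-leaf-05`, gen 83).  SOURCE READ first-hand in the held text layer [Balaban1985BackgroundPropagators]
(`paper:balaban1985-cmp99-background-propagators`, journal page = PDF page + 388): p. 392 (3.8) *«D*_U … the adjoint of D_U with respect to the scalar
product»*; p. 394 (3.23); p. 395 (3.28)–(3.31) *«⟨R(u)λ, Δ^η_{U^u}R(u)λ⟩ = ⟨λ, Δ^η_Uλ⟩»*; p. 397 (3.39).  [folklore] (the resolvent of a nonnegative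
self-adjoint operator plus a positive mass on a finite-dimensional Hilbert space); nothing printed is a hypothesis except the fibrewise isometry `hAd` of
`R(g x)` (unitarity; DERIVED for unitary `g` in `B9Eq328GaugeAction` ∕ `B9Eq387CubeReductionGaugeBackground`).

WHY THIS FILE (cell context).  `g82/V26-NEXT.md` item 2: storey J's junction `hT := (K29) §4` needs «the pure-gauge resolvent map `R⁰`» as a MAP
`h ↦ u`; `B9Eq331PureGaugeResolventConjugation` §4 is stated for ANY solution `u` of `Δ_{U⁰}u + m u = h`.  This file supplies the map (via `greenK`) and its
solution property in exactly that `hu` shape, plus the sup-norm value row — so the response map `T b h := (∇_{U⁰}(R⁰h))(b)` is a tree term (certified to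
inhabit `B9Eq342GradientRowBootstrap.norm_le_of_gradient_response_bootstrap`'s `hT` with the (K24) constant in the lineage's NOT-TO-FILE certificate
J-STOREYJ-2, `HOME/t4/b2b-balaban-t4-ne9-formalise-leaf-05/g83/jk29/`).

WHAT IS PROVED (sorry-free; 0 `def`; [folklore]).  `φ : W ≃ₗ[ℂ] 𝔸`, `g : TSite d P → 𝔸ˣ` with `hAd`, `U⁰ := gaugeU g 1`, real `t`, `m`.
* §1 **`inner_AdW_left_of_hAd`**, **`inner_AdW_inv_left_of_hAd`** (`⟪R(g x)p, q⟫ = ⟪p, R(g x)⁻¹q⟫` and the inverse law); **`inner_adTransportW_pureGauge`** —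
  the `hRS` binder of the chain (`⟪R(U⁰(b))v, u⟫ = ⟪v, R(U⁰(b)⁻¹)u⟫`) for the pure gauge, FROM `hAd`.
* §2 **`covLaplaceSiteK_pureGauge_eq_adjoint_comp`** (`Δ_{U⁰} = ∇_{U⁰}† ∘ ∇_{U⁰}` for real `t`), **`re_inner_covLaplaceSiteK_pureGauge`** (`re⟪f, Δ_{U⁰}f⟫ = ‖∇_{U⁰}f‖²`),
  **`rePos_covLaplaceSiteK_pureGauge_add`** (`0 < re⟪f, (Δ_{U⁰} + m·1)f⟫` for `f ≠ 0`, `m > 0`).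
* §3 (`W` finite-dimensional) **`pureGauge_resolvent_eq`** — `u := greenK (Δ_{U⁰} + m·1) _ h` solves `Δ_{U⁰}u + (m:ℂ)•u = h` (the `hu` shape of
  `B9Eq331PureGaugeResolventConjugation.norm_covDeriv_pureGauge_le_of_flat` and of `B9Eq373KatoPairedRemainderPureGauge`); **`pureGauge_resolvent_unique`**
  (any solution equals it); **`norm_pureGauge_resolvent_apply_le`** — `‖u(x)‖ ≤ Gs∕m` when `‖h(y)‖ ≤ Gs` (`B9Eq323KatoDomination.norm_le_of_covLaplaceSiteK_resolvent`
  with the isometries of `B9Eq331PureGaugeResolventConjugation` §6).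
HONEST SCOPE.  [folklore] functional analysis on a finite-dimensional space; the DECAY of `R⁰` (weights) is NOT here (it is the flat (K∇)∕(FS) chain through
§4 of the conjugation file); nothing of Bałaban's asserted.  NOT summit progress (cell pub-balaban: NE9 NOT PRINTED ∕ NOT PROVED; «NE9 ⇐ the named binders»; row
WALLED ON A MODEL (O-NE9-1; #5 UNRULED); spine PROVED 0∕9; rung (B)+1 finite T⁴ — NOT infinite volume, NOT mass gap, NOT BetaPertH, NOT Clay).  HONEST DEPENDENCY
(cell line): continuum YM on T⁴ ⇐ BetaPertH ∧ nine spine estimates (0/9 proved); BetaPertH ⇐ (D1) ∧ (D4) ∧ CAP+tail; G-an2-4 gates asym, D1 and NE2/3/4.  NEW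
file importing `B9Eq331PureGaugeResolventConjugation` only; nothing modified.  Net new unproved facts: 0.
-/

noncomputable section

open scoped BigOperators InnerProductSpace ComplexConjugate

namespace Literature.MathematicalPhysics.QuantumFieldTheory.Balaban1983to89.B9Eq331PureGaugeResolventLetters

open B4Sect5Torus (TSite)
open B9SectCLatticeCarrier (Bond bpos btgt)
open B9Eq311L2Pairing (WL2)
open B9Eq310HessianOperator (adTransportW)
open B11Eq103H1Complex (SiteL2K covLaplaceSiteK covDerivL2K covDivL2K greenK apply_greenK greenK_apply adjoint_covDerivL2K)
open B9Eq328GaugeAction (gaugeU AdW AdW_apply_inv)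
open B9Eq331PureGaugeResolventConjugation (adTransportW_pureGauge_apply adTransportW_pureGauge_inv_apply norm_adTransportW_pureGauge
  norm_adTransportW_pureGauge_inv adTransportW_inv_adTransportW)

variable {d : ℕ} {Pd : Fin d → ℕ} {𝔸 : Type*} [Ring 𝔸] [Algebra ℂ 𝔸] {W : Type*} [NormedAddCommGroup W] [InnerProductSpace ℂ W]
  (φ : W ≃ₗ[ℂ] 𝔸) {c₀ : ℝ} [Fact (0 < c₀)] (g : TSite d Pd → 𝔸ˣ)
  (hAd : ∀ (x : TSite d Pd) (v v' : W), ⟪AdW φ (g x) v, AdW φ (g x) v'⟫_ℂ = ⟪v, v'⟫_ℂ)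

/-! ## §1 The pure-gauge transporters are mutually adjoint (`hRS` from `hAd`) -/

include hAd in
/-- `⟪R(g x)p, q⟫ = ⟪p, R(g x)⁻¹q⟫`: the adjoint of a fibre isometry is its inverse. [folklore] [cite: Balaban1985BackgroundPropagators, (3.30) p.395] -/
theorem inner_AdW_left_of_hAd (x : TSite d Pd) (p q : W) : ⟪AdW φ (g x) p, q⟫_ℂ = ⟪p, AdW φ (g x)⁻¹ q⟫_ℂ := by
  conv_lhs => rw [← AdW_apply_inv φ (g x) q]
  rw [hAd]

include hAd in
/-- `⟪R(g x)⁻¹p, q⟫ = ⟪p, R(g x)q⟫`. [folklore] [cite: Balaban1985BackgroundPropagators, (3.30) p.395] -/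
theorem inner_AdW_inv_left_of_hAd (x : TSite d Pd) (p q : W) : ⟪AdW φ (g x)⁻¹ p, q⟫_ℂ = ⟪p, AdW φ (g x) q⟫_ℂ := by
  conv_rhs => rw [← AdW_apply_inv φ (g x) p]
  rw [hAd]

include hAd in
/-- **THE `hRS` BINDER FOR THE PURE GAUGE, FROM `hAd`**: `⟪R(U⁰(b))v, u⟫ = ⟪v, R(U⁰(b)⁻¹)u⟫` (`R(U⁰(b)) = R(g b₋)R(g b₊)⁻¹`). [folklore]
[cite: Balaban1985BackgroundPropagators, (3.8) p.392, (3.28)–(3.30) p.395] -/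
theorem inner_adTransportW_pureGauge (b : Bond d Pd) (v u : W) :
    ⟪adTransportW φ (gaugeU g 1) b v, u⟫_ℂ = ⟪v, adTransportW φ (fun b => (gaugeU g 1 b)⁻¹) b u⟫_ℂ := by
  rw [adTransportW_pureGauge_apply, adTransportW_pureGauge_inv_apply, inner_AdW_left_of_hAd φ g hAd, inner_AdW_inv_left_of_hAd φ g hAd]

/-! ## §2 `Δ_{U⁰} = ∇_{U⁰}†∇_{U⁰}` for real `t`; re-positivity of `Δ_{U⁰} + m` -/

include hAd in
/-- `Δ^η_{U⁰}f = ∇_{U⁰}†(∇_{U⁰}f)` for real `t` (`D* = D†`, `B11Eq103H1Complex.adjoint_covDerivL2K`). [folklore] [cite: Balaban1985BackgroundPropagators, (3.8) p.392, (3.23) p.394] -/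
theorem covLaplaceSiteK_pureGauge_eq_adjoint_comp [FiniteDimensional ℂ W] (t : ℝ) (f : SiteL2K ℂ d Pd c₀ W) :
    covLaplaceSiteK (t : ℂ) (adTransportW φ (gaugeU g 1)) (adTransportW φ fun b => (gaugeU g 1 b)⁻¹) f =
      LinearMap.adjoint (covDerivL2K ℂ c₀ (t : ℂ) (adTransportW φ (gaugeU g 1))) (covDerivL2K ℂ c₀ (t : ℂ) (adTransportW φ (gaugeU g 1)) f) := by
  rw [adjoint_covDerivL2K (t : ℂ) (Complex.conj_ofReal t) _ _ (inner_adTransportW_pureGauge φ g hAd)]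
  rfl

include hAd in
/-- **`re⟪f, Δ_{U⁰}f⟫ = ‖∇_{U⁰}f‖²`** for real `t`. [folklore] [cite: Balaban1985BackgroundPropagators, (3.23) p.394] -/
theorem re_inner_covLaplaceSiteK_pureGauge [FiniteDimensional ℂ W] (t : ℝ) (f : SiteL2K ℂ d Pd c₀ W) :
    RCLike.re ⟪f, covLaplaceSiteK (t : ℂ) (adTransportW φ (gaugeU g 1)) (adTransportW φ fun b => (gaugeU g 1 b)⁻¹) f⟫_ℂ =
      ‖covDerivL2K ℂ c₀ (t : ℂ) (adTransportW φ (gaugeU g 1)) f‖ ^ 2 := by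
  rw [covLaplaceSiteK_pureGauge_eq_adjoint_comp φ g hAd, LinearMap.adjoint_inner_right, inner_self_eq_norm_sq (𝕜 := ℂ)]

include hAd in
/-- **`Δ_{U⁰} + m` IS RE-POSITIVE for `m > 0`**: `0 < re⟪f, (Δ_{U⁰} + m·1)f⟫` for `f ≠ 0` — the `hpos` of `B11Eq103H1Complex.greenK`. [folklore]
[cite: Balaban1985BackgroundPropagators, (3.23) p.394] -/
theorem rePos_covLaplaceSiteK_pureGauge_add [FiniteDimensional ℂ W] (t : ℝ) {m : ℝ} (hm : 0 < m) (f : SiteL2K ℂ d Pd c₀ W) (hf : f ≠ 0) :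
    0 < RCLike.re ⟪f, ((covLaplaceSiteK (c₀ := c₀) (t : ℂ) (adTransportW φ (gaugeU g 1)) (adTransportW φ fun b => (gaugeU g 1 b)⁻¹) +
      (m : ℂ) • LinearMap.id : SiteL2K ℂ d Pd c₀ W →ₗ[ℂ] SiteL2K ℂ d Pd c₀ W)) f⟫_ℂ := by
  rw [LinearMap.add_apply, inner_add_right, map_add, re_inner_covLaplaceSiteK_pureGauge φ g hAd, LinearMap.smul_apply, LinearMap.id_apply,
    inner_smul_right]
  have h2 : RCLike.re ((m : ℂ) * ⟪f, f⟫_ℂ) = m * ‖f‖ ^ 2 := by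
    rw [RCLike.re_to_complex, Complex.re_ofReal_mul, ← RCLike.re_to_complex, inner_self_eq_norm_sq (𝕜 := ℂ)]
  rw [h2]
  have hf' : 0 < ‖f‖ := norm_pos_iff.mpr hf
  nlinarith [sq_nonneg ‖covDerivL2K ℂ c₀ (t : ℂ) (adTransportW φ (gaugeU g 1)) f‖, mul_pos hm (pow_pos hf' 2)]

/-! ## §3 The resolvent `R⁰ = (Δ_{U⁰} + m)⁻¹`: existence, uniqueness, value row -/

section Resolvent

variable [FiniteDimensional ℂ W] (t m : ℝ)

/-- (local, syntactic) the operator `Δ_{U⁰} + m·1` at the pure gauge as ONE linear map — a notation, not a definition. -/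
local notation "ΔmPG" => (covLaplaceSiteK (c₀ := c₀) ((t : ℝ) : ℂ) (adTransportW φ (gaugeU g 1)) (adTransportW φ fun b => (gaugeU g 1 b)⁻¹) +
  ((m : ℝ) : ℂ) • LinearMap.id : SiteL2K ℂ d Pd c₀ W →ₗ[ℂ] SiteL2K ℂ d Pd c₀ W)

include hAd in
/-- **THE PURE-GAUGE RESOLVENT SOLVES `Δ_{U⁰}u + m u = h`**: `u := greenK (Δ_{U⁰} + m·1) hpos h` with `hpos := rePos_covLaplaceSiteK_pureGauge_add` — the `hu`
shape of `B9Eq331PureGaugeResolventConjugation.norm_covDeriv_pureGauge_le_of_flat`. [folklore] [cite: Balaban1985BackgroundPropagators, (3.23) p.394; Balaban1985Variational, (110) p.294] -/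
theorem pureGauge_resolvent_eq (hm : 0 < m) (h : SiteL2K ℂ d Pd c₀ W) :
    covLaplaceSiteK (t : ℂ) (adTransportW φ (gaugeU g 1)) (adTransportW φ fun b => (gaugeU g 1 b)⁻¹)
        (greenK ΔmPG (rePos_covLaplaceSiteK_pureGauge_add φ g hAd t hm) h) +
      (m : ℂ) • greenK ΔmPG (rePos_covLaplaceSiteK_pureGauge_add φ g hAd t hm) h = h := by
  have e := apply_greenK (rePos_covLaplaceSiteK_pureGauge_add φ g hAd t hm) h
  rwa [LinearMap.add_apply, LinearMap.smul_apply, LinearMap.id_apply] at e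

include hAd in
/-- **UNIQUENESS**: any solution of `Δ_{U⁰}u + m u = h` is the resolvent value. [folklore] [cite: Balaban1985BackgroundPropagators, (3.23) p.394] -/
theorem pureGauge_resolvent_unique (hm : 0 < m) {u h : SiteL2K ℂ d Pd c₀ W}
    (hu : covLaplaceSiteK (t : ℂ) (adTransportW φ (gaugeU g 1)) (adTransportW φ fun b => (gaugeU g 1 b)⁻¹) u + (m : ℂ) • u = h) :
    u = greenK ΔmPG (rePos_covLaplaceSiteK_pureGauge_add φ g hAd t hm) h := by
  have e := greenK_apply (rePos_covLaplaceSiteK_pureGauge_add φ g hAd t hm) u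
  rw [LinearMap.add_apply, LinearMap.smul_apply, LinearMap.id_apply, hu] at e
  exact e.symm

include hAd in
/-- **THE VALUE ROW OF `R⁰`**: `‖h(y)‖ ≤ Gs` at every site ⟹ `‖(R⁰h)(x)‖ ≤ Gs∕m` — `B9Eq323KatoDomination.norm_le_of_covLaplaceSiteK_resolvent` at the isometric
transporters of the pure gauge. [folklore] [cite: Balaban1985BackgroundPropagators, (3.23) p.394, (3.39) p.397] -/
theorem norm_pureGauge_resolvent_apply_le (hm : 0 < m) (h : SiteL2K ℂ d Pd c₀ W) {Gs : ℝ} (hGs : ∀ y, ‖WL2.equiv ℂ _ W h y‖ ≤ Gs) (x : TSite d Pd) :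
    ‖WL2.equiv ℂ _ W (greenK ΔmPG (rePos_covLaplaceSiteK_pureGauge_add φ g hAd t hm) h) x‖ ≤ Gs / m :=
  B9Eq323KatoDomination.norm_le_of_covLaplaceSiteK_resolvent (𝕜 := ℂ) t _ _ (adTransportW_inv_adTransportW φ (gaugeU g 1))
    (fun b w => (norm_adTransportW_pureGauge φ g hAd b w).le) (fun b w => (norm_adTransportW_pureGauge_inv φ g hAd b w).le) hm
    (pureGauge_resolvent_eq φ g hAd t m hm h) hGs x

end Resolvent

end Literature.MathematicalPhysics.QuantumFieldTheory.Balaban1983to89.B9Eq331PureGaugeResolventLetters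

end
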